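import Mathlib.Geometry.Manifold.MFDeriv.SpecificFunctions
import Mathlib.Geometry.Manifold.IsManifold.Basic
import Mathlib.Analysis.Complex.Basic
import Mathlib.Topology.CompactOpen
import Mathlib.Topology.IsLocalHomeomorph
import Mathlib.Topology.Covering.Basic
import Mathlib.Topology.Algebra.Group.Matrix
import Mathlib.Topology.Algebra.Group.Quotient
import Mathlib.GroupTheory.Commensurable
import Mathlib.GroupTheory.Index

/-!
# Aut-holomorphic spaces ([AbsTopIII] §2: Definition 2.1 (i), (ii), Proposition 2.2, Corollary 2.3)

Statements-first typing (D-0014) of the "model-implicit" approach to holomorphic structures of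
S. Mochizuki, *Topics in absolute anabelian geometry III*, §2 (bib key `MochizukiAbsTopIII2015`).
Page locators `p.N` are the pages of the author's kurims manuscript (lit key
`paper:url-5493eb38cbb7`, 164 pp), not the journal pagination.

Contents (one declaration per printed sub-item):
* Def 2.1 (i) p.50: `AutHolStructure` (the assignment `U ↦ A_X(U) ≤ Aut(U^top)` on connected open
  subsets), `holAut` / `AutHolStructure.ofCharted` (the Aut-holomorphic structure of a Riemann
  surface: `A_X(U) = Aut^hol(U)`, REAL definition over Mathlib's `MDifferentiable`),
  `IsAutHolDisc`, `IsLocalStructure`, `PreAutHolStructure` / `AutHolStructure.restrict`;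
* Def 2.1 (ii) pp.50–51: `IsLocalMorphism` ((𝒰,𝒱)-local morphisms of Aut-holomorphic spaces),
  `IsMorphism`, `IsFiniteEtale`, `IsAntiHolAt` / `IsRCHolomorphic` (RC-holomorphic maps,
  [Mzk14] Def 1.1 (vi) as quoted on p.51);
* Prop 2.2 (i), (ii) p.52 and Cor 2.3 (i), (ii) p.53 as NAMED `Prop` FACTS (unproved published
  results; never asserted), Rmk 2.3.3 p.54 likewise.

Design choices.  The Aut-holomorphic structure is typed exactly as printed: DATA on the bare
topological space, with no reference to a model of `ℂ` (cf. Rmk 2.1.2, 2.7.4); the structure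
"associated to a Riemann surface" is the only place where Mathlib's complex-manifold library
enters.  The compact-open topology on `Aut(X^top)` (Prop 2.2 (ii)) is the topology induced from
`C(X,X)`; Mathlib has no instance on `X ≃ₜ X`, so it is a `def` used as a local instance.
`SL₂(ℝ)/{±1}` and `GL₂(ℝ)/ℝ^×` are typed as quotients by the centre.

Deliberately NOT here (next files of this slice): Def 2.1 (iii), (iv) (co-orientations via
`Orn(Z,p) = lim π₁(W∖{p})^ab`, co-holomorphicizations) and the second sentence of Cor 2.3 (i)
("precisely two co-holomorphicizations"), Rmk 2.1.1 (orbispaces), Rmk 2.3.1–2.3.2, and the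
reconstruction algorithms Cor 2.4–2.9, Prop 2.5–2.6.
-/

namespace Literature.AnabelianGeometry.AbsoluteAnabelian

open _root_.TopologicalSpace _root_.Topology
open scoped _root_.Manifold _root_.ContDiff

universe u

/-! ### Definition 2.1 (i): Aut-holomorphic structures and spaces -/

section DefI

variable (X : Type u) [TopologicalSpace X]

/-- The connected open subsets of a topological space `X^top` — the domain of the assignment
`U ↦ A_X(U)` of [AbsTopIII] Def 2.1 (i).
[cite: MochizukiAbsTopIII2015, Definition 2.1 (i) p.50] -/
abbrev ConnectedOpens : Type u := {U : Opens X // IsConnected (U : Set X)}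

/-- **Aut-holomorphic structures (generalised carrier).**  In print (Def 2.1 (i) p.50) the notion is
attached to a Riemann surface `X`: "Write `𝒜_X` for the assignment that assigns to each connected open
subset `U ⊆ X` the group `𝒜_X(U) := Aut^hol(U)` of holomorphic automorphisms of `U`", regarded as a
subgroup of `Aut(U^top)`; the pair `𝕏 = (X^top, 𝒜_X)` is the Aut-holomorphic space.  THIS structure is
our carrier type for such data on a bare topological space — an arbitrary assignment of subgroups
`A(U) ≤ Aut(U^top)` to connected opens (model-implicit: no copy of `ℂ`, cf. Rmk 2.1.2 p.52); the
PRINTED notion is the instance `AutHolStructure.ofCharted X` below, at which all facts are stated.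
[cite: MochizukiAbsTopIII2015, Definition 2.1 (i) p.50] -/
@[ext]
structure AutHolStructure : Type u where
  /-- `A_X(U) ⊆ Aut(U^top)` for a connected open `U`. -/
  aut : (U : ConnectedOpens X) → Subgroup (U.1 ≃ₜ U.1)

variable {X}

/-- For a space `X` charted over `ℂ` (a Riemann surface when it is moreover a complex manifold)
and an open `U ⊆ X`: the subgroup `Aut^hol(U) ⊆ Aut(U^top)` of self-homeomorphisms that are
holomorphic with holomorphic inverse (Mathlib `MDifferentiable` for the model `𝓘(ℂ, ℂ)`, `U`
carrying the restricted charted-space structure).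
[cite: MochizukiAbsTopIII2015, Definition 2.1 (i) p.50] -/
def holAut [ChartedSpace ℂ X] (U : Opens X) : Subgroup (U ≃ₜ U) where
  carrier := {φ | MDifferentiable 𝓘(ℂ, ℂ) 𝓘(ℂ, ℂ) (⇑φ) ∧
    MDifferentiable 𝓘(ℂ, ℂ) 𝓘(ℂ, ℂ) (⇑φ.symm)}
  one_mem' := ⟨mdifferentiable_id, mdifferentiable_id⟩
  mul_mem' := by
    rintro φ ψ ⟨h₁, h₂⟩ ⟨h₃, h₄⟩
    exact ⟨h₁.comp h₃, h₄.comp h₂⟩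
  inv_mem' := by
    rintro φ ⟨h₁, h₂⟩
    exact ⟨h₂, h₁⟩

/-- Membership in `Aut^hol(U)` unfolded.
[cite: MochizukiAbsTopIII2015, Definition 2.1 (i) p.50] -/
theorem mem_holAut_iff [ChartedSpace ℂ X] {U : Opens X} (φ : U ≃ₜ U) :
    φ ∈ holAut U ↔ MDifferentiable 𝓘(ℂ, ℂ) 𝓘(ℂ, ℂ) (⇑φ) ∧
      MDifferentiable 𝓘(ℂ, ℂ) 𝓘(ℂ, ℂ) (⇑φ.symm) := Iff.rfl

variable (X) in
/-- The **Aut-holomorphic structure associated to a Riemann surface** `X`: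
`A_X(U) := Aut^hol(U)` for every connected open `U ⊆ X`.  (Only the charted-space structure over
`ℂ` is needed to write the definition; the statements below assume `IsManifold 𝓘(ℂ, ℂ) ω X`.)
[cite: MochizukiAbsTopIII2015, Definition 2.1 (i) p.50] -/
def AutHolStructure.ofCharted [ChartedSpace ℂ X] : AutHolStructure X where
  aut U := holAut U.1

/-- The open unit disc as an open subset of `ℂ` (hence a space charted over `ℂ`), the model of an
"Aut-holomorphic disc".
[cite: MochizukiAbsTopIII2015, Definition 2.1 (i) p.50] -/
def unitDiscOpens : Opens ℂ := ⟨Metric.ball (0 : ℂ) 1, Metric.isOpen_ball⟩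

variable (X) in
/-- `X` is **biholomorphic to the open unit disc**; the associated Aut-holomorphic space is then
called an **Aut-holomorphic disc**.
[cite: MochizukiAbsTopIII2015, Definition 2.1 (i) p.50] -/
@[mk_iff]
structure IsAutHolDisc [ChartedSpace ℂ X] : Prop where
  exists_biholomorphic : ∃ e : X ≃ₜ unitDiscOpens,
    MDifferentiable 𝓘(ℂ, ℂ) 𝓘(ℂ, ℂ) (⇑e) ∧ MDifferentiable 𝓘(ℂ, ℂ) 𝓘(ℂ, ℂ) (⇑e.symm)

variable (X) in
/-- A **local structure** `𝒰` on `X^top`: a collection of connected open subsets that forms a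
basis for the topology and such that "any connected open subset of `X` that is contained in an
element of `𝒰` is itself an element of `𝒰`".
[cite: MochizukiAbsTopIII2015, Definition 2.1 (i) p.50] -/
@[mk_iff]
structure IsLocalStructure (𝒰 : Set (Opens X)) : Prop where
  isConnected : ∀ U ∈ 𝒰, IsConnected (U : Set X)
  isBasis : Opens.IsBasis 𝒰
  mem_of_le : ∀ U ∈ 𝒰, ∀ V : Opens X, IsConnected (V : Set X) → V ≤ U → V ∈ 𝒰

variable (X) in
/-- A `𝒰`-local **pre-Aut-holomorphic structure** on `X^top`: the datum `A|_𝒰` of groups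
`A(U) ⊆ Aut(U^top)` only for the members `U` of a local structure `𝒰`.
[cite: MochizukiAbsTopIII2015, Definition 2.1 (i) p.50] -/
structure PreAutHolStructure (𝒰 : Set (Opens X)) : Type u where
  /-- `A(U)` for `U ∈ 𝒰`. -/
  aut : (U : 𝒰) → Subgroup (U.1 ≃ₜ U.1)

/-- The restriction `A_X|_𝒰` of an Aut-holomorphic structure to a local structure `𝒰`
(a `𝒰`-local pre-Aut-holomorphic structure).
[cite: MochizukiAbsTopIII2015, Definition 2.1 (i) p.50] -/
def AutHolStructure.restrict (A : AutHolStructure X) {𝒰 : Set (Opens X)}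
    (h𝒰 : IsLocalStructure X 𝒰) : PreAutHolStructure X 𝒰 where
  aut U := A.aut ⟨U.1, h𝒰.isConnected U.1 U.2⟩

end DefI

/-! ### Definition 2.1 (ii): local morphisms, RC-holomorphic maps -/

section DefII

variable {X : Type u} [TopologicalSpace X] {Y : Type u} [TopologicalSpace Y]

/-- Conjugation by a homeomorphism `e : U ≃ₜ V` transports self-homeomorphisms:
`ψ ↦ e ∘ ψ ∘ e⁻¹`, a group isomorphism `Aut(U^top) ≅ Aut(V^top)` (used to say that a local
morphism "induces a bijection `A_X(U_X) ≅ A_Y(U_Y)`", Def 2.1 (ii) p.51). [folklore] -/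
def homeoConj {U V : Type u} [TopologicalSpace U] [TopologicalSpace V] (e : U ≃ₜ V) :
    (U ≃ₜ U) ≃* (V ≃ₜ V) where
  toFun ψ := e.symm.trans (ψ.trans e)
  invFun ψ := e.trans (ψ.trans e.symm)
  left_inv ψ := by ext x; simp
  right_inv ψ := by ext x; simp
  map_mul' ψ₁ ψ₂ := by ext x; simp [Homeomorph.mul_apply]

/-- A **(𝒰,𝒱)-local morphism of Aut-holomorphic spaces** `φ : 𝕏 → 𝕐` (printed for the Aut-holomorphic
spaces of Riemann surfaces; stated here on the generalised carrier): a local isomorphism of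
topological spaces `φ^top : X^top → Y^top` "with the property that for any open subset
`U_X ∈ 𝒰` that maps homeomorphically via `φ^top` onto some open subset `U_Y ∈ 𝒱`, `φ^top`
induces a bijection `A_X(U_X) ≅ A_Y(U_Y)`" (the bijection being transport of structure along
the homeomorphism `U_X ≅ U_Y` determined by `φ`).
[cite: MochizukiAbsTopIII2015, Definition 2.1 (ii) pp.50–51] -/
@[mk_iff]
structure IsLocalMorphism (A : AutHolStructure X) (B : AutHolStructure Y)
    (𝒰 : Set (Opens X)) (𝒱 : Set (Opens Y)) (φ : X → Y) : Prop where
  isLocalHomeomorph : IsLocalHomeomorph φ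
  map_aut_eq : ∀ (U : ConnectedOpens X) (V : ConnectedOpens Y), U.1 ∈ 𝒰 → V.1 ∈ 𝒱 →
    ∀ e : U.1 ≃ₜ V.1, (∀ x : U.1, (e x : Y) = φ x) →
      (A.aut U).map (homeoConj e).toMonoidHom = B.aut V

/-- A **morphism of Aut-holomorphic spaces** (printed for Riemann surfaces; stated on the
generalised carrier): a (𝒰,𝒱)-local morphism for `𝒰`, `𝒱` the sets of all connected open subsets.
[cite: MochizukiAbsTopIII2015, Definition 2.1 (ii) p.51] -/
def IsMorphism (A : AutHolStructure X) (B : AutHolStructure Y) (φ : X → Y) : Prop :=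
  IsLocalMorphism A B {U | IsConnected (U : Set X)} {V | IsConnected (V : Set Y)} φ

/-- A local morphism is **finite étale** when `φ^top` is a finite covering space map
(Mathlib `IsCoveringMap` with finite fibres).
[cite: MochizukiAbsTopIII2015, Definition 2.1 (ii) p.51] -/
@[mk_iff]
structure IsFiniteEtale (φ : X → Y) : Prop where
  isCoveringMap : IsCoveringMap φ
  finite_fibre : ∀ y : Y, (φ ⁻¹' {y}).Finite

variable [ChartedSpace ℂ X] [ChartedSpace ℂ Y]

/-- `f : X → Y` (spaces charted over `ℂ`) is **holomorphic at `x`**: `ℂ`-differentiable (Mathlib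
`MDifferentiableAt` for `𝓘(ℂ, ℂ)`) at every point of a neighbourhood of `x`.
[cite: MochizukiAbsTopIII2015, Definition 2.1 (ii) p.51] -/
def IsHolAt (f : X → Y) (x : X) : Prop :=
  ∀ᶠ y in 𝓝 x, MDifferentiableAt 𝓘(ℂ, ℂ) 𝓘(ℂ, ℂ) f y

/-- `f : X → Y` is **anti-holomorphic at `x`**: at every point `y` of a neighbourhood of `x`, `f` is
continuous and the complex conjugate of its expression in the preferred charts at `y` is
`ℂ`-differentiable (the "anti-holomorphic" half of [Mzk14] Def 1.1 (vi) as recalled on p.51).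
[cite: MochizukiAbsTopIII2015, Definition 2.1 (ii) p.51] -/
def IsAntiHolAt (f : X → Y) (x : X) : Prop :=
  ∀ᶠ y in 𝓝 x, ContinuousAt f y ∧
    DifferentiableAt ℂ (starRingEnd ℂ ∘ writtenInExtChartAt 𝓘(ℂ, ℂ) 𝓘(ℂ, ℂ) y f)
      (extChartAt 𝓘(ℂ, ℂ) y y)

/-- An **RC-holomorphic morphism**: a map "which is either holomorphic or anti-holomorphic at
each point of `X`" ([Mzk14] Def 1.1 (vi), as recalled in the text) — each point has a neighbourhood
on which `f` is holomorphic, or one on which it is anti-holomorphic.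
[cite: MochizukiAbsTopIII2015, Definition 2.1 (ii) p.51] -/
def IsRCHolomorphic (f : X → Y) : Prop :=
  ∀ x : X, IsHolAt f x ∨ IsAntiHolAt f x

/-- The set `Aut^{RC-hol}(X) ⊆ Aut(X^top)` of RC-holomorphic self-homeomorphisms with
RC-holomorphic inverse (Prop 2.2 (ii) asserts it is a subgroup containing `Aut^hol(X)` with
index two).
[cite: MochizukiAbsTopIII2015, Proposition 2.2 (ii) p.52] -/
def rcHolAutSet (U : Opens X) : Set (U ≃ₜ U) :=
  {φ | IsRCHolomorphic (⇑φ) ∧ IsRCHolomorphic (⇑φ.symm)}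

end DefII

/-! ### Proposition 2.2 and Corollary 2.3 (named facts) -/

section Facts

/-- The **compact-open topology on `Aut(Y^top)`**: the topology induced from Mathlib's
compact-open topology on `C(Y, Y)` along `φ ↦ (φ : C(Y,Y))` (Prop 2.2 (ii): "regard the group
`Aut(X^top)` as equipped with the compact-open topology").  A `def`, used as a local instance.
[cite: MochizukiAbsTopIII2015, Proposition 2.2 (ii) p.52] -/
@[reducible] def homeoCompactOpen (Y : Type u) [TopologicalSpace Y] : TopologicalSpace (Y ≃ₜ Y) :=
  TopologicalSpace.induced (fun φ => (φ : C(Y, Y))) ContinuousMap.compactOpen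

attribute [local instance] homeoCompactOpen

/-- **Prop 2.2 (i)** (Commensurable Terminality of RC-Holomorphic Automorphisms of the Disc):
for Aut-holomorphic discs `𝕏`, `𝕐` arising from Riemann surfaces `X`, `Y`, "every isomorphism of
Aut-holomorphic spaces `𝕏 ≅ 𝕐` arises from a unique RC-holomorphic isomorphism `X ≅ Y`" — typed:
a homeomorphism that is a morphism of the associated Aut-holomorphic spaces in both directions
is an RC-holomorphic isomorphism, i.e. `φ` and `φ⁻¹` are RC-holomorphic (uniqueness is then
tautological: the underlying map is `φ` itself).  Named `Prop` fact (statement only; not asserted).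
[cite: MochizukiAbsTopIII2015, Proposition 2.2 (i) p.52] -/
def DiscAutHolIsoIsRCHolomorphic : Prop :=
  ∀ (X Y : Type) [TopologicalSpace X] [T2Space X] [ChartedSpace ℂ X]
    [IsManifold 𝓘(ℂ, ℂ) ω X] [TopologicalSpace Y] [T2Space Y] [ChartedSpace ℂ Y]
    [IsManifold 𝓘(ℂ, ℂ) ω Y], IsAutHolDisc X → IsAutHolDisc Y →
    ∀ φ : X ≃ₜ Y, IsMorphism (AutHolStructure.ofCharted X) (AutHolStructure.ofCharted Y) φ →
      IsMorphism (AutHolStructure.ofCharted Y) (AutHolStructure.ofCharted X) φ.symm →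
      IsRCHolomorphic (⇑φ) ∧ IsRCHolomorphic (⇑φ.symm)

/-- **Prop 2.2 (ii)**, first part: for an Aut-holomorphic disc `X`, with `Aut(X^top)` carrying
the compact-open topology, "the subgroup `Aut^{RC-hol}(X) ⊆ Aut(X^top)` of RC-holomorphic
automorphisms of `X`, which contains `Aut^hol(X)` as a subgroup of index two, is closed and
commensurably terminal" (commensurator equal to itself, Mathlib `Subgroup.Commensurable.commensurator`).
Typed for `X = ⊤ ⊆ X` so that `Aut^hol` is the `holAut` of Def 2.1 (i).  Named `Prop` fact.
[cite: MochizukiAbsTopIII2015, Proposition 2.2 (ii) p.52] -/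
def DiscRCHolAutClosedCommTerminal : Prop :=
  ∀ (X : Type) [TopologicalSpace X] [T2Space X] [ChartedSpace ℂ X] [IsManifold 𝓘(ℂ, ℂ) ω X],
    IsAutHolDisc X →
    ∃ H : Subgroup ((⊤ : Opens X) ≃ₜ (⊤ : Opens X)),
      (H : Set ((⊤ : Opens X) ≃ₜ (⊤ : Opens X))) = rcHolAutSet (⊤ : Opens X) ∧
      holAut (⊤ : Opens X) ≤ H ∧ (holAut (⊤ : Opens X)).relIndex H = 2 ∧
      IsClosed (H : Set ((⊤ : Opens X) ≃ₜ (⊤ : Opens X))) ∧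
      Subgroup.Commensurable.commensurator H = H

/-- **Prop 2.2 (ii)**, second part: for an Aut-holomorphic disc `X`, "we have isomorphisms of
topological groups `Aut^hol(X) ≅ SL₂(ℝ)/{±1}`, `Aut^{RC-hol}(X) ≅ GL₂(ℝ)/ℝ^×`", the
automorphism groups topologised by the compact-open topology of `Aut(X^top)`; `{±1}` and `ℝ^×`
(scalars) are the centres, so the targets are typed as quotients by `Subgroup.center`.
Named `Prop` fact.
[cite: MochizukiAbsTopIII2015, Proposition 2.2 (ii) p.52] -/
def DiscHolAutIsoPSL2R : Prop :=
  ∀ (X : Type) [TopologicalSpace X] [T2Space X] [ChartedSpace ℂ X] [IsManifold 𝓘(ℂ, ℂ) ω X],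
    IsAutHolDisc X →
    Nonempty (holAut (⊤ : Opens X) ≃ₜ*
        (Matrix.SpecialLinearGroup (Fin 2) ℝ ⧸
          Subgroup.center (Matrix.SpecialLinearGroup (Fin 2) ℝ))) ∧
    ∃ H : Subgroup ((⊤ : Opens X) ≃ₜ (⊤ : Opens X)),
      (H : Set ((⊤ : Opens X) ≃ₜ (⊤ : Opens X))) = rcHolAutSet (⊤ : Opens X) ∧
      Nonempty (H ≃ₜ* (GL (Fin 2) ℝ ⧸ Subgroup.center (GL (Fin 2) ℝ)))

/-- **Cor 2.3 (i)** (Morphisms of Aut-Holomorphic Spaces), first sentence: for Riemann surfaces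
`X`, `Y` with local structures `𝒰`, `𝒱`, "every (𝒰,𝒱)-local morphism of Aut-holomorphic spaces
`φ : 𝕏 → 𝕐` arises from a unique étale RC-holomorphic morphism `ψ : X → Y`" — typed: the
underlying local homeomorphism `φ` is itself RC-holomorphic.  Named `Prop` fact.
[cite: MochizukiAbsTopIII2015, Corollary 2.3 (i) p.53] -/
def LocalMorphismIsRCHolomorphic : Prop :=
  ∀ (X Y : Type) [TopologicalSpace X] [T2Space X] [ChartedSpace ℂ X]
    [IsManifold 𝓘(ℂ, ℂ) ω X] [TopologicalSpace Y] [T2Space Y] [ChartedSpace ℂ Y]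
    [IsManifold 𝓘(ℂ, ℂ) ω Y] (𝒰 : Set (Opens X)) (𝒱 : Set (Opens Y)),
    IsLocalStructure X 𝒰 → IsLocalStructure Y 𝒱 → ∀ φ : X → Y,
      IsLocalMorphism (AutHolStructure.ofCharted X) (AutHolStructure.ofCharted Y) 𝒰 𝒱 φ →
      IsRCHolomorphic φ

/-- **Cor 2.3 (ii)**: "every pre-Aut-holomorphic structure on `X^top` extends to a unique
Aut-holomorphic structure on `X^top`" — typed as the uniqueness clause (existence is the
tautological extension by the structure it was restricted from): two Riemann-surface structures
on the same topological space whose Aut-holomorphic structures agree on a local structure `𝒰`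
have equal Aut-holomorphic structures.  Named `Prop` fact.
[cite: MochizukiAbsTopIII2015, Corollary 2.3 (ii) p.53] -/
def PreAutHolStructureExtendsUnique : Prop :=
  ∀ (X : Type) [TopologicalSpace X] [T2Space X] (c₁ c₂ : ChartedSpace ℂ X),
    @IsManifold ℂ _ ℂ _ _ ℂ _ 𝓘(ℂ, ℂ) ω X _ c₁ → @IsManifold ℂ _ ℂ _ _ ℂ _ 𝓘(ℂ, ℂ) ω X _ c₂ →
    ∀ (𝒰 : Set (Opens X)) (h𝒰 : IsLocalStructure X 𝒰),
      (@AutHolStructure.ofCharted X _ c₁).restrict h𝒰 =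
          (@AutHolStructure.ofCharted X _ c₂).restrict h𝒰 →
      @AutHolStructure.ofCharted X _ c₁ = @AutHolStructure.ofCharted X _ c₂

/-- **Rmk 2.3.3**: "any composite of morphisms of Aut-holomorphic spaces is again a morphism of
Aut-holomorphic spaces" (stated for Aut-holomorphic spaces of Riemann surfaces, where it follows
from Cor 2.3 (i)).  Named `Prop` fact.
[cite: MochizukiAbsTopIII2015, Remark 2.3.3 p.54] -/
def MorphismCompClosed : Prop :=
  ∀ (X Y Z : Type) [TopologicalSpace X] [T2Space X] [ChartedSpace ℂ X]
    [IsManifold 𝓘(ℂ, ℂ) ω X] [TopologicalSpace Y] [T2Space Y] [ChartedSpace ℂ Y]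
    [IsManifold 𝓘(ℂ, ℂ) ω Y] [TopologicalSpace Z] [T2Space Z] [ChartedSpace ℂ Z]
    [IsManifold 𝓘(ℂ, ℂ) ω Z] (φ : X → Y) (ψ : Y → Z),
    IsMorphism (AutHolStructure.ofCharted X) (AutHolStructure.ofCharted Y) φ →
    IsMorphism (AutHolStructure.ofCharted Y) (AutHolStructure.ofCharted Z) ψ →
    IsMorphism (AutHolStructure.ofCharted X) (AutHolStructure.ofCharted Z) (ψ ∘ φ)

end Facts

/-! ### Elementary consequences of the definitions (sanity of the typing) -/

section Sanity

variable {X : Type u} [TopologicalSpace X] [ChartedSpace ℂ X]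

/-- The identity homeomorphism belongs to `Aut^hol(U)`.
[cite: MochizukiAbsTopIII2015, Definition 2.1 (i) p.50] -/
theorem refl_mem_holAut (U : Opens X) : Homeomorph.refl U ∈ holAut U :=
  (holAut U).one_mem

/-- `Aut^hol(U) ⊆ Aut^{RC-hol}(U)`: a holomorphic automorphism is RC-holomorphic (the trivial
inclusion behind "contains `Aut^hol(X)` as a subgroup of index two").
[cite: MochizukiAbsTopIII2015, Proposition 2.2 (ii) p.52] -/
theorem holAut_subset_rcHolAutSet (U : Opens X) :
    ((holAut U : Subgroup (U ≃ₜ U)) : Set (U ≃ₜ U)) ⊆ rcHolAutSet U := by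
  rintro φ ⟨h₁, h₂⟩
  exact ⟨fun x => Or.inl (Filter.Eventually.of_forall fun y => h₁ y),
    fun x => Or.inl (Filter.Eventually.of_forall fun y => h₂ y)⟩

/-- The Aut-holomorphic structure of a Riemann surface evaluates to `Aut^hol`.
[cite: MochizukiAbsTopIII2015, Definition 2.1 (i) p.50] -/
@[simp] theorem AutHolStructure.ofCharted_aut (U : ConnectedOpens X) :
    (AutHolStructure.ofCharted X).aut U = holAut U.1 := rfl

end Sanity

end Literature.AnabelianGeometry.AbsoluteAnabelian
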